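import Summits.AtomisticToContinuum.BoseEinsteinCondensation.Theorems.BECCutLineWeakDisorderLateCoreSplitZeroModeNecessityBounded
import Summits.AtomisticToContinuum.BoseEinsteinCondensation.Theorems.BECInfraredBoundAssembly
import HarnessLib

/-!
# Crux `TwoReplicaTransienceBound` (stmt-AtomisticToContinuum-9687), line `late-core-split`:
# the necessity certificate in the SUMMIT's vocabulary (`HasGroundStateBEC`, LSSY (1.19))

Support file (`--supports stmt-AtomisticToContinuum-9687`; closes nothing; lead c18).

The landed certificate `stub_zeroModeNecessityBounded` (…LateCoreSplitZeroModeNecessityBounded.lean,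
p143443) says: the crux implies the zero-mode thesis of item stmt-AtomisticToContinuum-0686 at every
essentially bounded admissible pair potential. Here that conclusion is pushed one step further, to the
predicate the audited sub-problem `BoseEinsteinCondensation` is MADE of:

* `hasGroundStateBEC_of_zeroModeAt` — the proved assembly `bec_of_zeroMode` of route BECInfraredBound
  run at ONE potential and ONE density: macroscopic occupation of the flat mode `φ₀ = L^{-3/2} 1_Λ`
  in every `δ`-near-minimiser gives LSSY's criterion `HasGroundStateBEC v ρ` (the flat mode is a
  normalised measurable mode, `occupation ≤ maxOccupation`, `le_condensateNumber`);
* **`hasGroundStateBEC_essBounded_of_crux`** (registered toolbox stub `stub_summitNecessityBounded`)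
  — `TwoReplicaTransienceBound` implies `HasGroundStateBEC v ρ` for EVERY essentially bounded
  repulsive finite-range `v` at EVERY density `0 < ρ < ρ₀(v)`: on soft spheres the crux contains the
  summit conjunct itself — ground-state Bose–Einstein condensation of the dilute three-dimensional gas
  in the thermodynamic limit (LSSY2005 §1.2 (1.19), Ch. 5: open);
* `boseEinsteinCondensation_of_crux_of_singularBEC` — hence the ONLY gap between the crux and the
  sub-problem statement `BoseEinsteinCondensation` is the class of admissible potentials that are NOT
  essentially bounded (hard cores / hollow shells, where rigidity of near-minimisers = the hard-core
  half of crux stmt-AtomisticToContinuum-9072 is open): the crux plus BEC on that class gives the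
  sub-problem by name;
* `not_crux_of_not_hasGroundStateBEC` — contrapositive, the refutation test in summit terms: one
  soft admissible `v` whose dilute ground states fail LSSY's criterion along densities `ρ → 0`
  refutes the crux.

Reading (LeadC18Report.md): any proof of the crux is, already on soft potentials, a proof of the
summit conjunct's defining property; the lead verdict `blocked-on: stmt-AtomisticToContinuum-0686`
(tenth consecutive seat) is this fact as a scheduling statement.
-/

noncomputable section

namespace Summit.AtomisticToContinuum.BoseEinsteinCondensation.Cruxes.TwoReplicaTransienceBound.LateCoreSplit

open MeasureTheory Filter Set
open scoped ENNReal NNReal Topology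
open Literature.MathematicalPhysics.QuantumManyBody.BoseGas
open Summit.AtomisticToContinuum.BoseEinsteinCondensation.Theses
open Summit.AtomisticToContinuum.BoseEinsteinCondensation.Theses.BECCutLineWeakDisorder
open Summit.AtomisticToContinuum.BoseEinsteinCondensation.Theorems

/-- **The assembly of route BECInfraredBound at one potential and one density.** If for some `c > 0`,
for all large `N`, some `δ > 0` makes every `δ`-near-minimiser of the Dirichlet energy in the box of
side `(N/ρ)^{1/3}` occupy the flat mode `φ₀ = L^{-3/2} 1_Λ` macroscopically (`≥ cN`), then LSSY's
criterion `HasGroundStateBEC v ρ` holds (`λ_max(γ) ≥ ⟨φ₀, γ φ₀⟩`, then `le_condensateNumber`).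
[cite: LSSY2005, §1.2 (1.17)–(1.19)] -/
theorem hasGroundStateBEC_of_zeroModeAt {v : ℝ → ℝ≥0∞} {ρ : ℝ} (hρ : 0 < ρ)
    (h : ∃ c : ℝ, 0 < c ∧ ∀ᶠ N : ℕ in atTop, ∃ δ : ℝ≥0∞, 0 < δ ∧
      ∀ Ψ : TrialState N (sideLength ρ N),
        energy v Ψ ≤ groundStateEnergy v N (sideLength ρ N) + δ →
        ENNReal.ofReal (c * N) ≤ occupation N ((box (sideLength ρ N)).indicator
          fun _ => ((Real.sqrt (sideLength ρ N ^ 3))⁻¹ : ℂ)) Ψ.ψ) :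
    HasGroundStateBEC v ρ := by
  obtain ⟨c, hc, hev⟩ := h
  refine ⟨c, hc, ?_⟩
  filter_upwards [hev, eventually_gt_atTop 0] with N hN hNpos
  obtain ⟨δ, hδ, hΨ⟩ := hN
  have hL : 0 < sideLength ρ N := by
    unfold sideLength
    exact Real.rpow_pos_of_pos (div_pos (Nat.cast_pos.mpr hNpos) hρ) _
  exact le_condensateNumber v hδ fun Ψ hE =>
    (hΨ Ψ hE).trans (occupation_le_maxOccupation _
      (_root_.AtomisticToContinuum.BECInfraredBound.aestronglyMeasurable_constMode _)
      (_root_.AtomisticToContinuum.BECInfraredBound.lintegral_constMode_sq hL))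

/-- **`TwoReplicaTransienceBound` ⟹ LSSY's BEC criterion for every soft potential.** For every
essentially bounded repulsive finite-range `v` there is `ρ₀ > 0` such that `HasGroundStateBEC v ρ` for
all `0 < ρ < ρ₀`: the crux (through the proved transfer `WitnessTransfer`, the flat-mode glue and
Perron–Frobenius rigidity, all packaged in `stub_zeroModeNecessityBounded`, p143443) followed by the
one-potential assembly `hasGroundStateBEC_of_zeroModeAt`. On soft spheres the crux therefore contains
the summit conjunct's defining property. [cite: LSSY2005, §1.2 (1.19) and Ch. 5 p. 42] -/
theorem hasGroundStateBEC_essBounded_of_crux (hT : TwoReplicaTransienceBound) :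
    ∀ v : ℝ → ℝ≥0∞, IsRepulsiveFiniteRange v → (∃ C : ℝ≥0, ∀ᵐ r : ℝ, v r ≤ C) →
      ∃ ρ₀ : ℝ, 0 < ρ₀ ∧ ∀ ρ : ℝ, 0 < ρ → ρ < ρ₀ → HasGroundStateBEC v ρ := by
  intro v hv hb
  obtain ⟨ρ₀, hρ₀, H⟩ := stub_zeroModeNecessityBounded hT v hv hb
  exact ⟨ρ₀, hρ₀, fun ρ hρ hρlt => hasGroundStateBEC_of_zeroModeAt hρ (H ρ hρ hρlt)⟩

/-- The same for potentials bounded everywhere (`v ≤ C`). [cite: LSSY2005, §1.2 (1.19)] -/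
theorem hasGroundStateBEC_bounded_of_crux (hT : TwoReplicaTransienceBound) :
    ∀ v : ℝ → ℝ≥0∞, IsRepulsiveFiniteRange v → (∃ C : ℝ≥0, ∀ r : ℝ, v r ≤ C) →
      ∃ ρ₀ : ℝ, 0 < ρ₀ ∧ ∀ ρ : ℝ, 0 < ρ → ρ < ρ₀ → HasGroundStateBEC v ρ :=
  fun v hv ⟨C, hC⟩ => hasGroundStateBEC_essBounded_of_crux hT v hv ⟨C, Eventually.of_forall hC⟩

/-- **Registered toolbox stub `stub_summitNecessityBounded`** (= `hasGroundStateBEC_essBounded_of_crux`,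
verbatim registered signature): the crux implies the summit conjunct's predicate `HasGroundStateBEC`
at every essentially bounded admissible potential and every small density.
[cite: LSSY2005, §1.2 (1.19) and Ch. 5 p. 42] -/
theorem stub_summitNecessityBounded : Summit.AtomisticToContinuum.BoseEinsteinCondensation.Theses.BECCutLineWeakDisorder.TwoReplicaTransienceBound → ∀ v : ℝ → ENNReal, Literature.MathematicalPhysics.QuantumManyBody.BoseGas.IsRepulsiveFiniteRange v → (∃ C : NNReal, ∀ᵐ r : ℝ, v r ≤ C) → ∃ ρ₀ : ℝ, 0 < ρ₀ ∧ ∀ ρ : ℝ, 0 < ρ → ρ < ρ₀ → Literature.MathematicalPhysics.QuantumManyBody.BoseGas.HasGroundStateBEC v ρ :=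
  hasGroundStateBEC_essBounded_of_crux

/-- **The only gap between the crux and the sub-problem is the singular (not essentially bounded)
class.** `TwoReplicaTransienceBound`, together with dilute ground-state BEC for the admissible
potentials that are NOT essentially bounded (hard cores, hollow shells — where rigidity of
near-minimisers, the hard-core half of crux stmt-AtomisticToContinuum-9072, is open), gives the
sub-problem statement `BoseEinsteinCondensation` by name. [cite: LSSY2005, §1.2 and Ch. 5 p. 42] -/
theorem boseEinsteinCondensation_of_crux_of_singularBEC (hT : TwoReplicaTransienceBound)
    (hS : ∀ v : ℝ → ℝ≥0∞, IsRepulsiveFiniteRange v → ¬ (∃ C : ℝ≥0, ∀ᵐ r : ℝ, v r ≤ C) →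
      ∃ ρ₀ : ℝ, 0 < ρ₀ ∧ ∀ ρ : ℝ, 0 < ρ → ρ < ρ₀ → HasGroundStateBEC v ρ) :
    Literature.MathematicalPhysics.QuantumManyBody.BoseGas.BoseEinsteinCondensation := by
  intro v hv
  by_cases hb : ∃ C : ℝ≥0, ∀ᵐ r : ℝ, v r ≤ C
  · exact hasGroundStateBEC_essBounded_of_crux hT v hv hb
  · exact hS v hv hb

/-- **Contrapositive — the refutation test in summit terms.** One essentially bounded admissible `v`
for which LSSY's criterion fails at densities accumulating at `0` (for every `ρ₀ > 0` some
`ρ ∈ (0, ρ₀)` without `HasGroundStateBEC v ρ`) refutes the crux. [cite: LSSY2005, §1.2 (1.19)] -/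
theorem not_crux_of_not_hasGroundStateBEC {v : ℝ → ℝ≥0∞} (hv : IsRepulsiveFiniteRange v)
    (hb : ∃ C : ℝ≥0, ∀ᵐ r : ℝ, v r ≤ C)
    (h : ∀ ρ₀ : ℝ, 0 < ρ₀ → ∃ ρ : ℝ, 0 < ρ ∧ ρ < ρ₀ ∧ ¬ HasGroundStateBEC v ρ) :
    ¬ TwoReplicaTransienceBound := by
  intro hT
  obtain ⟨ρ₀, hρ₀, H⟩ := hasGroundStateBEC_essBounded_of_crux hT v hv hb
  obtain ⟨ρ, hρ, hρlt, hno⟩ := h ρ₀ hρ₀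
  exact hno (H ρ hρ hρlt)

end Summit.AtomisticToContinuum.BoseEinsteinCondensation.Cruxes.TwoReplicaTransienceBound.LateCoreSplit

end
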